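import Literature.Barriers.CriticalPhenomena.TimarFiniteLevelUnionCut
import Literature.Barriers.CriticalPhenomena.TimarCutClassesQuasiTransitive
import Literature.Barriers.CriticalPhenomena.TimarLemma53TargetsQuasiTransitive
import HarnessLib

/-!
# Timár 2006, Thm. 5.5 on QUASI-TRANSITIVE graphs by the cut route: the assembly —
# `Timar2006_finiteLevelUnion_quasiTransitive` PROVED

Barrier catalogue `Literature/Barriers/CriticalPhenomena/`; the quasi-transitive twin of
`TimarFiniteLevelUnionCut.lean` (TRANSITIVE graphs: `Timar2006_finiteLevelUnion_holds`). Á. Timár,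
*Percolation on nonunimodular transitive graphs*, Ann. Probab. 34 (2006) 2344–2364, §5, Thm. 5.5
("Consider Bernoulli percolation on some nonunimodular transitive graph `G` and suppose that it
has infinitely many heavy components. Then with probability 1, for any [heavy] component `C`,
there is some finite union `L` of levels such that `L ∩ C` has some infinite connected component"),
in the quasi-transitive setting in which Hutchcroft (2016, §2) uses it. The printed proof and the
tree's cut route go through with three replacements, carried out in the sibling
`…QuasiTransitive` files: the extreme edge ratio `δ` for `Δ` (`TimarEdgeRatioQuasiTransitive`),
bounded climbs/descents for long edges in Lemma 5.2 (`TimarHeavySlabsQuasiTransitiveW`), and the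
Mass-Transport Principle summed over orbit representatives (`NonunimodularMTPQuasiTransitive`,
`TimarCutQuasiTransitive`, `TimarMassTransportQuasiTransitive`); the level group `R` is enlarged to
contain all heights (`TimarLevelExhaustionQuasiTransitive`).

This file repeats the assembly of the tree file on the sample space
`CutSpaceQ G hqt o = ((ω, θ), labels) × seeds(R)`: law, diagonal action, random data (points =
encounter points of bad heavy clusters, `cutPoints`, reused; pointing relation `cutPQ`; classes
`cutClsQ`), the class and forest packages, the exhaustion in probability, and the conclusion via
`measure_mem_eq_zero_of_cut_exhaustion_quasiTransitive`; then Thm. 5.5: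
`Timar2006_finiteLevelUnion_quasiTransitive` (reduction to "almost surely infinitely many bad heavy
clusters", `TimarBadClusters.lean`, whose zero–one part is already quasi-transitive; Lemma 5.3 (i)
`not_ae_forall_not_badEncounter`, reused; Lemma 5.3 (ii)
`ae_exists_isEncounter_of_branch_quasiTransitive`).

## References

* Á. Timár, Ann. Probab. 34 (2006) 2344–2364 (arXiv:math/0702875), §5: Lemma 5.3, Prop. 5.4,
  Thm. 5.5 and its proof. [Timar2006]
* T. Hutchcroft, C. R. Math. Acad. Sci. Paris 354 (2016) 944–947, §2 (proof of Thm. 1.1: Timár's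
  theorem for quasi-transitive nonunimodular graphs). [Hutchcroft2016]
* R. Lyons, Y. Peres, *Probability on Trees and Networks*, CUP 2016, §8.2 ((8.10)). [LyonsPeres2016]
-/

noncomputable section

namespace Literature.Barriers.CriticalPhenomena

open _root_.MeasureTheory _root_.Filter Literature.Probability.Percolation SimpleGraph
open scoped _root_.ENNReal _root_.Topology

variable {V : Type*}

attribute [local instance] isProbabilityMeasure_labelMeasure

/-! ### Degrees on a quasi-transitive graph -/

/-- The largest degree of a representative. [folklore] -/
def qtSupDegree (G : SimpleGraph V) [G.LocallyFinite] (hqt : IsQuasiTransitive G) : ℕ :=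
  (qtReps hqt).sup fun s => G.degree s

/-- **Degrees are bounded on a quasi-transitive locally finite graph.** [folklore] -/
theorem degree_le_qtSupDegree {G : SimpleGraph V} [G.LocallyFinite] (hqt : IsQuasiTransitive G) (v : V) :
    G.degree v ≤ qtSupDegree G hqt := by
  obtain ⟨γ, hγ⟩ := exists_map_mem_qtReps hqt v
  have h : G.degree v = G.degree (γ v) := by
    rw [← SimpleGraph.card_neighborSet_eq_degree, ← SimpleGraph.card_neighborSet_eq_degree,
      Fintype.card_congr (γ.mapNeighborSet v)]
  rw [h]
  exact Finset.le_sup (f := fun s => G.degree s) hγ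

/-! ### The sample space, its law and the action of `Aut(G)` -/

section Space

variable (G : SimpleGraph V) [G.LocallyFinite] (hconn : G.Connected) (hqt : IsQuasiTransitive G)
  (o : V)

/-- **The sample space of the cut route**: the percolation configuration, the parameter of the
1-partition, i.i.d. labels on `Sym2 V` (the vertex `v` is labelled by the label of `s(v, v)`),
and the seeds of the exhaustion of the levels.
[cite: Timar2006, Thm. 5.5 (proof: "the 1-partition, the percolation and some additional randomness")] -/
abbrev CutSpaceQ : Type _ :=
  ((BondConfig V × UnitAddCircle) × (Sym2 V → ℝ)) × ExhaustionSeeds (heightGroupQ G hqt o)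

variable {G hqt o} in
/-- The configuration coordinate. [folklore] -/
abbrev CutSpaceQ.conf (ζ : CutSpaceQ G hqt o) : BondConfig V := ζ.1.1.1
variable {G hqt o} in
/-- The parameter of the 1-partition. [folklore] -/
abbrev CutSpaceQ.par (ζ : CutSpaceQ G hqt o) : UnitAddCircle := ζ.1.1.2
variable {G hqt o} in
/-- The vertex labels (diagonal of the edge labels). [folklore] -/
abbrev CutSpaceQ.lab (ζ : CutSpaceQ G hqt o) (v : V) : ℝ := ζ.1.2 s(v, v)
variable {G hqt o} in
/-- The seed of the exhaustion. [folklore] -/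
abbrev CutSpaceQ.seed (ζ : CutSpaceQ G hqt o) : ExhaustionSeeds (heightGroupQ G hqt o) := ζ.2

/-- **The law**: Bernoulli(`p`) percolation, Haar probability on the circle, i.i.d. uniform
labels and the seed measure, all independent. [cite: Timar2006, Thm. 5.5 (proof: independent extra randomness)] -/
def cutMeasureQ (p : unitInterval) : Measure (CutSpaceQ G hqt o) :=
  (((bondPercolation G p).prod (volume : Measure UnitAddCircle)).prod (labelMeasure V)).prod
    (boxSeedMeasure (LevelCoordIndex (heightGroupQ G hqt o)))

/-- **The diagonal action of `Aut(G)`** on the sample space. [cite: Timar2006, Thm. 5.5 (proof: "equivariant")] -/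
def cutActQ (γ : G ≃g G) : CutSpaceQ G hqt o → CutSpaceQ G hqt o :=
  Prod.map (Prod.map (Prod.map (BondConfig.relabel (sym2Equiv γ.toEquiv)) (onePartitionActQ G o γ))
    (actLabels γ)) (levelExhaustionActQ G hconn hqt o γ)

/-- The law is a probability measure. [folklore] -/
instance isProbabilityMeasure_cutMeasureQ [Countable V] (p : unitInterval) :
    IsProbabilityMeasure (cutMeasureQ G hqt o p) := by
  unfold cutMeasureQ; infer_instance

/-- The action is by measurable maps … [folklore] -/
theorem measurable_cutActQ (γ : G ≃g G) : Measurable (cutActQ G hconn hqt o γ) :=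
  (((BondConfig.relabel (sym2Equiv γ.toEquiv)).measurable.prodMap (measurable_onePartitionActQ γ)).prodMap
    (measurable_actLabels γ)).prodMap (measurable_levelExhaustionActQ G hconn hqt o γ)

/-- … preserving the law. [cite: Timar2006, Thm. 5.5 (proof: invariance of the extra randomness)] -/
theorem measurePreserving_cutActQ [Countable V] (p : unitInterval) (γ : G ≃g G) :
    MeasurePreserving (cutActQ G hconn hqt o γ) (cutMeasureQ G hqt o p) (cutMeasureQ G hqt o p) := by
  unfold cutActQ cutMeasureQ
  refine MeasurePreserving.prod (MeasurePreserving.prod (MeasurePreserving.prod ?_ ?_) ?_) ?_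
  · exact ⟨(BondConfig.relabel (sym2Equiv γ.toEquiv)).measurable, bondPercolation_map_relabel_iso γ p⟩
  · exact measurePreserving_onePartitionActQ γ
  · exact ⟨measurable_actLabels γ, labelMeasure_map_actLabels γ⟩
  · exact measurePreserving_levelExhaustionActQ G hconn hqt o γ

/-- `Measure.map` form of the invariance. [folklore] -/
theorem map_cutActQ [Countable V] (p : unitInterval) (γ : G ≃g G) :
    (cutMeasureQ G hqt o p).map (cutActQ G hconn hqt o γ) = cutMeasureQ G hqt o p :=
  (measurePreserving_cutActQ G hconn hqt o p γ).map_eq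

/-! #### The coordinates -/

variable {G hqt o}

/-- The coordinates are measurable. [folklore] -/
theorem measurable_confQ : Measurable (CutSpaceQ.conf : CutSpaceQ G hqt o → BondConfig V) :=
  measurable_fst.fst.fst

/-- The parameter is measurable. [folklore] -/
theorem measurable_parQ : Measurable (CutSpaceQ.par : CutSpaceQ G hqt o → UnitAddCircle) :=
  measurable_fst.fst.snd

/-- Each vertex label is measurable. [folklore] -/
theorem measurable_labQ (v : V) : Measurable fun ζ : CutSpaceQ G hqt o => ζ.lab v :=
  (measurable_pi_apply _).comp measurable_fst.snd

/-- The seed is measurable. [folklore] -/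
theorem measurable_seedQ : Measurable (CutSpaceQ.seed : CutSpaceQ G hqt o → ExhaustionSeeds (heightGroupQ G hqt o)) :=
  measurable_snd

/-- The action on the coordinates: configuration. [folklore] -/
@[simp] theorem conf_cutActQ (γ : G ≃g G) (ζ : CutSpaceQ G hqt o) :
    (cutActQ G hconn hqt o γ ζ).conf = BondConfig.relabel (sym2Equiv γ.toEquiv) ζ.conf := rfl

/-- The action on the coordinates: parameter. [folklore] -/
@[simp] theorem par_cutActQ (γ : G ≃g G) (ζ : CutSpaceQ G hqt o) :
    (cutActQ G hconn hqt o γ ζ).par = onePartitionActQ G o γ ζ.par := rfl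

/-- The action on the coordinates: seed. [folklore] -/
@[simp] theorem seed_cutActQ (γ : G ≃g G) (ζ : CutSpaceQ G hqt o) :
    (cutActQ G hconn hqt o γ ζ).seed = levelExhaustionActQ G hconn hqt o γ ζ.seed := rfl

/-- **The vertex labels are equivariant**: the label of `γ v` after the action is the label of
`v`. [folklore] -/
@[simp] theorem lab_cutActQ (γ : G ≃g G) (ζ : CutSpaceQ G hqt o) (v : V) :
    (cutActQ G hconn hqt o γ ζ).lab (γ v) = ζ.lab v := by
  show ζ.1.2 ((sym2Equiv γ.toEquiv.symm) s(γ v, γ v)) = ζ.1.2 s(v, v)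
  have hv : γ.toEquiv.symm (γ v) = v := γ.toEquiv.symm_apply_apply v
  rw [sym2Equiv_apply, Sym2.map_mk]
  erw [hv]

end Space

/-! ### The random data of the cut route -/

section Data

variable {G : SimpleGraph V} [G.LocallyFinite] {hconn : G.Connected} {hqt : IsQuasiTransitive G} {o : V}

/-- The random points `D`. [cite: Timar2006, Thm. 5.5 (proof: the set W)] -/
def cutDQ (G : SimpleGraph V) [G.LocallyFinite] (hqt : IsQuasiTransitive G) (o : V) (ζ : CutSpaceQ G hqt o) : Set V := cutPoints G o ζ.conf

/-- The random pointing relation `M⃗`: targets in the class of the 1-partition, ties broken by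
the labels. [cite: Timar2006, Thm. 5.5 (proof: the digraph M⃗)] -/
def cutPQ (G : SimpleGraph V) [G.LocallyFinite] (hqt : IsQuasiTransitive G) (o : V) (ζ : CutSpaceQ G hqt o) (x t : V) : Prop :=
  Points (openGraph ζ.conf) (cutPoints G o ζ.conf) (OnePartitionRelQ G o ζ.par) ζ.lab x t

/-- The random classes at stage `i`. [cite: Timar2006, Thm. 5.5 (proof: the partitions R_i)] -/
def cutClsQ (G : SimpleGraph V) [G.LocallyFinite] (hconn : G.Connected) (hqt : IsQuasiTransitive G)
    (o : V) (i : ℕ) (ζ : CutSpaceQ G hqt o) (x : V) : Set V :=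
  cutClassQ G hconn hqt o ζ.par i ζ.seed ζ.conf (cutPoints G o ζ.conf) x

/-! #### Invariance -/

/-- `D` is equivariant. [folklore] -/
theorem mem_cutD_act_iffQ (hconn : G.Connected) (hqt : IsQuasiTransitive G) (γ : G ≃g G)
    (ζ : CutSpaceQ G hqt o) (x : V) : γ x ∈ cutDQ G hqt o (cutActQ G hconn hqt o γ ζ) ↔ x ∈ cutDQ G hqt o ζ :=
  mem_cutPoints_relabel_iff hconn γ o ζ.conf x

/-- The points after the action are the image of the points. [folklore] -/
theorem cutPoints_actQ (hconn : G.Connected) (hqt : IsQuasiTransitive G) (γ : G ≃g G) (ζ : CutSpaceQ G hqt o) :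
    cutPoints G o (cutActQ G hconn hqt o γ ζ).conf = (γ : V → V) '' cutPoints G o ζ.conf := by
  ext y
  constructor
  · intro hy
    refine ⟨γ.symm y, ?_, γ.apply_symm_apply y⟩
    rw [← mem_cutPoints_relabel_iff hconn γ o ζ.conf, γ.apply_symm_apply]; exact hy
  · rintro ⟨x, hx, rfl⟩; exact (mem_cutPoints_relabel_iff hconn γ o ζ.conf x).2 hx

/-- `M⃗` is equivariant. [cite: Timar2006, Thm. 5.5 (proof: "an equivariant function")] -/
theorem cutP_act_iffQ (hconn : G.Connected) (hqt : IsQuasiTransitive G) (γ : G ≃g G) (ζ : CutSpaceQ G hqt o)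
    (x t : V) : cutPQ G hqt o (cutActQ G hconn hqt o γ ζ) (γ x) (γ t) ↔ cutPQ G hqt o ζ x t := by
  unfold cutPQ
  exact points_iso_iff (openGraphRelabelIso γ.toEquiv ζ.conf)
    (Wset := cutPoints G o ζ.conf) (Wset' := cutPoints G o (cutActQ G hconn hqt o γ ζ).conf)
    (R := OnePartitionRelQ G o ζ.par) (R' := OnePartitionRelQ G o (cutActQ G hconn hqt o γ ζ).par)
    (ℓ := ζ.lab) (ℓ' := (cutActQ G hconn hqt o γ ζ).lab)
    (fun y => mem_cutPoints_relabel_iff hconn γ o ζ.conf y)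
    (fun a b => onePartitionRelQ_act_iff hconn γ ζ.par a b) (fun v => lab_cutActQ hconn γ ζ v) x t

/-- The classes are equivariant. [cite: Timar2006, Thm. 5.5 (proof: "an equivariant exhaustion R_i")] -/
theorem mem_cutCls_act_iffQ (hconn : G.Connected) (hqt : IsQuasiTransitive G) (i : ℕ) (γ : G ≃g G)
    (ζ : CutSpaceQ G hqt o) (x y : V) :
    γ y ∈ cutClsQ G hconn hqt o i (cutActQ G hconn hqt o γ ζ) (γ x) ↔ y ∈ cutClsQ G hconn hqt o i ζ x := by
  unfold cutClsQ
  rw [cutPoints_actQ hconn hqt γ ζ]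
  exact mem_cutClass_act_iffQ ζ.par i ζ.seed ζ.conf (cutPoints G o ζ.conf) γ x y

/-! #### Measurability -/

variable [Countable V]

/-- `{x ∈ D}` is measurable. [folklore] -/
theorem measurableSet_mem_cutDQ (x : V) : MeasurableSet {ζ : CutSpaceQ G hqt o | x ∈ cutDQ G hqt o ζ} :=
  (measurableSet_mem_cutPoints (G := G) o x).preimage measurable_confQ

omit [Countable V] in
/-- The adjacency events of the random open graph are measurable. [folklore] -/
theorem measurableSet_openGraph_conf_adjQ (a b : V) :
    MeasurableSet {ζ : CutSpaceQ G hqt o | (openGraph ζ.conf).Adj a b} :=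
  measurableSet_openGraph_adj_comp measurable_confQ a b

/-- `{x → t}` is measurable. [folklore] -/
theorem measurableSet_cutPQ (x t : V) : MeasurableSet {ζ : CutSpaceQ G hqt o | cutPQ G hqt o ζ x t} :=
  measurableSet_points (Γ := fun ζ : CutSpaceQ G hqt o => openGraph ζ.conf) measurableSet_openGraph_conf_adjQ
    (W := fun ζ => cutPoints G o ζ.conf) (R := fun ζ => OnePartitionRelQ G o ζ.par) (ℓ := fun ζ => ζ.lab)
    measurableSet_mem_cutDQ
    (fun a b => (measurableSet_setOf_onePartitionRelQ a b).preimage measurable_parQ) measurable_labQ x t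

/-- `{y ∈ cls_i(x)}` is measurable. [folklore] -/
theorem measurableSet_mem_cutClsQ (i : ℕ) (x y : V) :
    MeasurableSet {ζ : CutSpaceQ G hqt o | y ∈ cutClsQ G hconn hqt o i ζ x} :=
  measurableSet_mem_cutClassQ measurable_confQ measurable_parQ measurable_seedQ measurableSet_mem_cutDQ i x y

end Data

/-! ### The class package and the forest package -/

section Packages

variable {G : SimpleGraph V} [G.LocallyFinite]

/-- **The class package** (all sure): the classes through the points partition the points, are
finite (badness) and carry the weight bound `w(x) ≤ Δ⁻¹ w(y)`. [cite: Timar2006, Thm. 5.5 (proof: the partitions R_i)] -/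
theorem cutCls_packageQ (hconn : G.Connected) (hqt : IsQuasiTransitive G) (hU : ¬ IsGraphUnimodular G)
    (o : V) (ζ : CutSpaceQ G hqt o) (i : ℕ) (x : V) (hx : x ∈ cutDQ G hqt o ζ) :
    x ∈ cutClsQ G hconn hqt o i ζ x ∧ cutClsQ G hconn hqt o i ζ x ⊆ cutDQ G hqt o ζ ∧
      (∀ y ∈ cutClsQ G hconn hqt o i ζ x, cutClsQ G hconn hqt o i ζ y = cutClsQ G hconn hqt o i ζ x) ∧
      (cutClsQ G hconn hqt o i ζ x).Finite ∧
      ∀ y ∈ cutClsQ G hconn hqt o i ζ x, autWeight G o x ≤ (minEdgeRatio G)⁻¹ * autWeight G o y :=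
  ⟨mem_cutClass_selfQ hx, cutClass_subsetQ _ _ _ _ _ _, fun _ hy => cutClass_eq_of_memQ hy,
    cutClass_finiteQ hx.2.1, fun _ hy => autWeight_le_of_mem_cutClassQ hU hy⟩

/-- Injective edge labels give vertex labels injective on every set. [folklore] -/
theorem injOn_lab_of_injectiveQ {hqt : IsQuasiTransitive G} {o : V} {ζ : CutSpaceQ G hqt o} (h : Function.Injective ζ.1.2) (S : Set V) :
    Set.InjOn ζ.lab S := by
  intro a _ b _ hab
  have h2 : s(a, a) = s(b, b) := h hab
  exact (Sym2.eq_iff.1 h2).elim (fun h' => h'.1) (fun h' => h'.1)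

/-- **The forest package, from Lemma 5.3 (ii)**: if the labels are injective, `ω ⊆ E(G)`, and
every heavy branch at every point (branch of a vertex of its cluster) contains an encounter point of the class of `x` (5.3 ii at `ω, θ`), then
the pointing graph is acyclic, pointing pairs are off-diagonal, every point has `3 ≤ #targets`,
and every vertex has `#targets ≤ deg o`.
[cite: Timar2006, Thm. 5.5 (proof: the forest F, degrees ≥ 3) and Lemma 5.3] -/
theorem cutP_packageQ (hqt : IsQuasiTransitive G) (o : V) (ζ : CutSpaceQ G hqt o)
    (hlab : Function.Injective ζ.1.2) (hE : ζ.conf ⊆ G.edgeSet)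
    (h53 : ∀ x ∈ cutPoints G o ζ.conf, ∀ u ∈ openCluster ζ.conf x, IsHeavy G o (branchSet ζ.conf x u) →
      ∃ z ∈ branchSet ζ.conf x u, IsEncounter G o ζ.conf z ∧ OnePartitionRelQ G o ζ.par x z) :
    (pointGraph (cutPQ G hqt o ζ)).IsAcyclic ∧ (∀ a b, cutPQ G hqt o ζ a b → a ≠ b) ∧
      (∀ x ∈ cutDQ G hqt o ζ, 3 ≤ ({t | cutPQ G hqt o ζ x t} : Set V).encard) ∧
      ∀ x, ({t | cutPQ G hqt o ζ x t} : Set V).encard ≤ (qtSupDegree G hqt : ℕ) := by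
  have hΓ : openGraph ζ.conf ≤ G := fun a b hab => G.mem_edgeSet.1 (hE ((openGraph_adj _ a b).1 hab).1)
  have hRs : ∀ {a b}, OnePartitionRelQ G o ζ.par a b → OnePartitionRelQ G o ζ.par b a :=
    fun h => (onePartitionRelQ_equivalence G o ζ.par).symm h
  have hRt : ∀ {a b c}, OnePartitionRelQ G o ζ.par a b → OnePartitionRelQ G o ζ.par b c →
      OnePartitionRelQ G o ζ.par a c := fun h h' => (onePartitionRelQ_equivalence G o ζ.par).trans h h'
  have hinj : Set.InjOn ζ.lab (cutPoints G o ζ.conf) := injOn_lab_of_injectiveQ hlab _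
  refine ⟨?_, ?_, ?_, ?_⟩
  · -- `pointGraph (Points …) = targetGraph …`
    have : pointGraph (cutPQ G hqt o ζ) =
        targetGraph (openGraph ζ.conf) (cutPoints G o ζ.conf) (OnePartitionRelQ G o ζ.par) ζ.lab := by
      ext a b; rfl
    rw [this]
    exact targetGraph_isAcyclic hRs hRt hinj
  · rintro a b ⟨-, u, htar⟩
    exact (htar.1.1.ne_right).symm
  · intro x hx
    obtain ⟨u, hu, hsep, hheavy⟩ := hx.2.2
    refine three_le_encard_setOf_points hΓ hx u hsep fun i => ?_
    obtain ⟨z, hzB, hzE, hzR⟩ := h53 x hx (u i) (hu i) (hheavy i)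
    have hzC : z ∈ openCluster ζ.conf x := by
      have h1 : z ∈ openCluster ζ.conf (u i) := branchSet_subset_openCluster ζ.conf x (u i) hzB
      exact (show (openGraph ζ.conf).Reachable x (u i) from hu i).trans h1
    refine ⟨z, hzB, hzC, ⟨?_, hx.2.1.of_mem hzC, hzE⟩, hzR⟩
    -- `C(z) = C(x)` is heavy
    have hCz : openCluster ζ.conf z = openCluster ζ.conf x :=
      Set.ext fun w => ⟨fun hw => Reachable.trans hzC hw, fun hw => Reachable.trans hzC.symm hw⟩
    rw [hCz]; exact hx.1
  · intro x
    exact (encard_setOf_points_le_degree hΓ hinj x).trans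
      (by exact_mod_cast degree_le_qtSupDegree hqt x)

end Packages

/-! ### Marginals of the law -/

section Marginals

variable {G : SimpleGraph V} [G.LocallyFinite] {hqt : IsQuasiTransitive G} {o : V} [Countable V]

/-- The configuration marginal: `μ̃(conf ∈ A) = P_p(A)`. [folklore] -/
theorem cutMeasure_setOf_conf_memQ (p : unitInterval) (A : Set (BondConfig V)) :
    cutMeasureQ G hqt o p {ζ | ζ.conf ∈ A} = bondPercolation G p A := by
  have h : {ζ : CutSpaceQ G hqt o | ζ.conf ∈ A} =
      ((A ×ˢ (Set.univ : Set UnitAddCircle)) ×ˢ (Set.univ : Set (Sym2 V → ℝ))) ×ˢ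
        (Set.univ : Set (ExhaustionSeeds (heightGroupQ G hqt o))) := by
    ext ζ; simp [CutSpaceQ.conf]
  rw [h, cutMeasureQ, Measure.prod_prod, Measure.prod_prod, Measure.prod_prod]
  simp

/-- The label marginal: `μ̃(labels ∈ B) = labelMeasure(B)`. [folklore] -/
theorem cutMeasure_setOf_labels_memQ (p : unitInterval) (B : Set (Sym2 V → ℝ)) :
    cutMeasureQ G hqt o p {ζ | ζ.1.2 ∈ B} = labelMeasure V B := by
  have h : {ζ : CutSpaceQ G hqt o | ζ.1.2 ∈ B} =
      (((Set.univ : Set (BondConfig V × UnitAddCircle))) ×ˢ B) ×ˢ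
        (Set.univ : Set (ExhaustionSeeds (heightGroupQ G hqt o))) := by
    ext ζ; simp
  rw [h, cutMeasureQ, Measure.prod_prod, Measure.prod_prod]
  simp

/-- The `(ω, θ)` marginal: `μ̃((conf, par) ∈ C) = (P_p ⊗ Haar)(C)`. [folklore] -/
theorem cutMeasure_setOf_confPar_memQ (p : unitInterval) (C : Set (BondConfig V × UnitAddCircle)) :
    cutMeasureQ G hqt o p {ζ | ζ.1.1 ∈ C} = ((bondPercolation G p).prod (volume : Measure UnitAddCircle)) C := by
  have h : {ζ : CutSpaceQ G hqt o | ζ.1.1 ∈ C} =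
      (C ×ˢ (Set.univ : Set (Sym2 V → ℝ))) ×ˢ (Set.univ : Set (ExhaustionSeeds (heightGroupQ G hqt o))) := by
    ext ζ; simp
  rw [h, cutMeasureQ, Measure.prod_prod, Measure.prod_prod]
  simp

/-- Almost surely the configuration lies in `E(G)`. [folklore] -/
theorem ae_conf_subsetQ (p : unitInterval) : ∀ᵐ ζ ∂(cutMeasureQ G hqt o p), ζ.conf ⊆ G.edgeSet := by
  rw [ae_iff]
  have h := cutMeasure_setOf_conf_memQ (G := G) (hqt := hqt) (o := o) p {ω | ¬ ω ⊆ G.edgeSet}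
  simp only [Set.mem_setOf_eq] at h
  rw [h]
  exact ae_iff.1 (ProbabilityTheory.setBernoulli_ae_subset (u := G.edgeSet) (p := p))

/-- Almost surely the labels are injective. [folklore] -/
theorem ae_labels_injectiveQ (p : unitInterval) : ∀ᵐ ζ ∂(cutMeasureQ G hqt o p), Function.Injective ζ.1.2 := by
  rw [ae_iff]
  have h := cutMeasure_setOf_labels_memQ (G := G) (hqt := hqt) (o := o) p {U | ¬ Function.Injective U}
  simp only [Set.mem_setOf_eq] at h
  rw [h]
  exact ae_iff.1 ae_injective_labelMeasure

/-- An almost sure statement about `(ω, θ)` lifts to the sample space. [folklore] -/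
theorem ae_confPar_of_aeQ (p : unitInterval) {P : BondConfig V × UnitAddCircle → Prop}
    (h : ∀ᵐ q ∂((bondPercolation G p).prod (volume : Measure UnitAddCircle)), P q) :
    ∀ᵐ ζ ∂(cutMeasureQ G hqt o p), P ζ.1.1 := by
  rw [ae_iff]
  have h' := cutMeasure_setOf_confPar_memQ (G := G) (hqt := hqt) (o := o) p {q | ¬ P q}
  simp only [Set.mem_setOf_eq] at h'
  rw [h']
  exact ae_iff.1 h

end Marginals

/-! ### The exhaustion in probability -/

section Exhaustion

variable {G : SimpleGraph V} [G.LocallyFinite] [Countable V]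

omit [Countable V] in
/-- **The cut event lies in the split event**: if `x → t` and `t ∉ cls_i(x)` (and `ω ⊆ E(G)`),
then `x, t` are joined by an open path and, for EVERY finite `F` through which they are joined by
an open path, some vertex of `F` is not `P_i`-related to `x` (`mem_cutClass_of_walk`).
[cite: Timar2006, Thm. 5.5 (proof: "the endpoints of any edge of Φ are in the same component of R_i" fails only when levels are split)] -/
theorem cutEvent_subsetQ (hconn : G.Connected) (hqt : IsQuasiTransitive G) (o : V) (i : ℕ) (x t : V) :
    {ζ : CutSpaceQ G hqt o | cutPQ G hqt o ζ x t ∧ t ∉ cutClsQ G hconn hqt o i ζ x} ⊆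
      {ζ | ¬ ζ.conf ⊆ G.edgeSet} ∪
      {ζ | (openGraph ζ.conf).Reachable x t ∧ ∀ F : Finset V, x ∈ F →
        t ∈ openClusterIn (withinGraph ⊤ (↑F : Set V)) ζ.conf x →
          ∃ v ∈ F, ¬ LevelExhaustionRelQ G hconn hqt o i ζ.seed x v} := by
  rintro ζ ⟨⟨-, u, htar⟩, hnot⟩
  by_cases hE : ζ.conf ⊆ G.edgeSet
  · right
    refine ⟨htar.1.2.1, fun F hxF htF => ?_⟩
    by_contra hall
    push Not at hall
    obtain ⟨q⟩ := (mem_openClusterIn_iff.1 htF)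
    obtain ⟨π, hπ⟩ := exists_openWalk_of_reachable_within q (Finset.mem_coe.2 hxF)
    exact hnot (mem_cutClass_of_walkQ hE htar.1.2.2.1 htar.1.2.2.2 π
      fun v hv => hall v (Finset.mem_coe.1 (hπ v hv)))
  · exact Or.inl hE

/-- The split event is measurable. [folklore] -/
theorem measurableSet_splitEventQ (hconn : G.Connected) (hqt : IsQuasiTransitive G) (o : V) (i : ℕ)
    (x t : V) :
    MeasurableSet {ζ : CutSpaceQ G hqt o | (openGraph ζ.conf).Reachable x t ∧ ∀ F : Finset V, x ∈ F →
      t ∈ openClusterIn (withinGraph ⊤ (↑F : Set V)) ζ.conf x →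
        ∃ v ∈ F, ¬ LevelExhaustionRelQ G hconn hqt o i ζ.seed x v} := by
  have h : {ζ : CutSpaceQ G hqt o | (openGraph ζ.conf).Reachable x t ∧ ∀ F : Finset V, x ∈ F →
      t ∈ openClusterIn (withinGraph ⊤ (↑F : Set V)) ζ.conf x →
        ∃ v ∈ F, ¬ LevelExhaustionRelQ G hconn hqt o i ζ.seed x v} =
      {ζ | (openGraph ζ.conf).Reachable x t} ∩ ⋂ F : Finset V,
        ({ζ | x ∈ F ∧ ζ.conf ∈ openConnVia (withinGraph ⊤ (↑F : Set V)) x t}ᶜ ∪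
          ⋃ v ∈ F, {ζ | ¬ LevelExhaustionRelQ G hconn hqt o i ζ.seed x v}) := by
    ext ζ
    simp only [Set.mem_setOf_eq, Set.mem_inter_iff, Set.mem_iInter, Set.mem_union, Set.mem_compl_iff,
      Set.mem_iUnion, openConnVia, not_and, exists_prop]
    refine and_congr_right fun _ => forall_congr' fun F => ?_
    constructor
    · intro h'
      by_cases hxF : x ∈ F
      · by_cases htF : t ∈ openClusterIn (withinGraph ⊤ (↑F : Set V)) ζ.conf x
        · exact Or.inr (h' hxF htF)
        · exact Or.inl fun _ => htF
      · exact Or.inl fun h => absurd h hxF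
    · rintro (h' | h') hxF htF
      · exact absurd htF (h' hxF)
      · exact h'
  rw [h]
  refine (measurableSet_reachable_comp measurable_confQ x t).inter (MeasurableSet.iInter fun F => ?_)
  refine (((MeasurableSet.const _).inter ((measurableSet_openConnVia _ x t).preimage measurable_confQ)).compl).union ?_
  exact Finset.measurableSet_biUnion F fun v _ =>
    ((measurableSet_setOf_levelExhaustionRelQ G hconn hqt o i x v).preimage measurable_seedQ).compl

/-- **The split event has probability tending to zero** (Fubini over the seeds: above a fixed
`(ω, θ, U)` with `x ↔ t`, the section is contained in "the levels of the vertices of a fixed open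
path from `x` to `t` are not inside one class of `P_i`", `tendsto_measure_not_forall_levelExhaustionRel`;
dominated convergence). [cite: Timar2006, Thm. 5.5 (proof: "with probability tending to 1") and Prop. 5.4] -/
theorem tendsto_cutMeasure_splitEventQ (hconn : G.Connected) (hqt : IsQuasiTransitive G) (o : V)
    (p : unitInterval) (x t : V) :
    Tendsto (fun i => cutMeasureQ G hqt o p {ζ : CutSpaceQ G hqt o | (openGraph ζ.conf).Reachable x t ∧
      ∀ F : Finset V, x ∈ F → t ∈ openClusterIn (withinGraph ⊤ (↑F : Set V)) ζ.conf x →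
        ∃ v ∈ F, ¬ LevelExhaustionRelQ G hconn hqt o i ζ.seed x v}) atTop (𝓝 0) := by
  classical
  set μ₁ := ((bondPercolation G p).prod (volume : Measure UnitAddCircle)).prod (labelMeasure V) with hμ₁
  set ν := boxSeedMeasure (LevelCoordIndex (heightGroupQ G hqt o)) with hν
  set S : ℕ → Set (CutSpaceQ G hqt o) := fun i => {ζ | (openGraph ζ.conf).Reachable x t ∧
      ∀ F : Finset V, x ∈ F → t ∈ openClusterIn (withinGraph ⊤ (↑F : Set V)) ζ.conf x →
        ∃ v ∈ F, ¬ LevelExhaustionRelQ G hconn hqt o i ζ.seed x v} with hS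
  have hSm : ∀ i, MeasurableSet (S i) := fun i => measurableSet_splitEventQ hconn hqt o i x t
  change Tendsto (fun i => cutMeasureQ G hqt o p (S i)) atTop (𝓝 0)
  -- Fubini
  have happ : ∀ i, cutMeasureQ G hqt o p (S i) = ∫⁻ ζ₁, ν (Prod.mk ζ₁ ⁻¹' S i) ∂μ₁ := fun i => by
    rw [cutMeasureQ, Measure.prod_apply (hSm i)]
  simp_rw [happ]
  -- pointwise: the section is small
  have hpt : ∀ ζ₁, Tendsto (fun i => ν (Prod.mk ζ₁ ⁻¹' S i)) atTop (𝓝 0) := by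
    intro ζ₁
    by_cases hr : (openGraph ζ₁.1.1).Reachable x t
    · obtain ⟨π⟩ := hr
      set F₀ : Finset V := π.support.toFinset with hF₀
      have hxF₀ : x ∈ F₀ := by rw [hF₀, List.mem_toFinset]; exact π.start_mem_support
      have hsub : ∀ i, Prod.mk ζ₁ ⁻¹' S i ⊆
          {ξ | ¬ ∀ a ∈ F₀, ∀ b ∈ F₀, LevelExhaustionRelQ G hconn hqt o i ξ a b} := by
        intro i ξ hξ hall
        obtain ⟨-, hF⟩ := hξ
        have htF : t ∈ openClusterIn (withinGraph ⊤ (↑F₀ : Set V)) ζ₁.1.1 x :=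
          mem_openClusterIn_iff.2 (reachable_within_of_openWalk π fun v hv => by
            rw [Finset.mem_coe, hF₀, List.mem_toFinset]; exact hv)
        obtain ⟨v, hv, hnot⟩ := hF F₀ hxF₀ htF
        exact hnot (hall x hxF₀ v hv)
      exact tendsto_of_tendsto_of_tendsto_of_le_of_le tendsto_const_nhds
        (tendsto_measure_not_forall_levelExhaustionRelQ G hconn hqt o F₀)
        (fun i => bot_le) (fun i => measure_mono (hsub i))
    · have h0 : ∀ i, Prod.mk ζ₁ ⁻¹' S i = ∅ := fun i =>
        Set.eq_empty_of_forall_notMem fun ξ hξ => hr hξ.1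
      have hf : (fun i => ν (Prod.mk ζ₁ ⁻¹' S i)) = fun _ => 0 := funext fun i => by
        rw [h0 i, measure_empty]
      rw [hf]
      exact tendsto_const_nhds
  have hmeas : ∀ i, Measurable fun ζ₁ => ν (Prod.mk ζ₁ ⁻¹' S i) := fun i =>
    measurable_measure_prodMk_left (hSm i)
  have h := tendsto_lintegral_of_dominated_convergence (μ := μ₁) (fun _ => ν Set.univ) hmeas
    (fun i => Eventually.of_forall fun ζ₁ => measure_mono (Set.subset_univ _))
    (by rw [lintegral_const]; exact ENNReal.mul_ne_top (measure_ne_top _ _) (measure_ne_top _ _))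
    (Eventually.of_forall hpt)
  simpa only [lintegral_zero] using h

/-- **The exhaustion in probability**: `μ̃(x → t, t ∉ cls_i(x)) → 0`.
[cite: Timar2006, Thm. 5.5 (proof: "the sequence (R_i) exhausts Φ")] -/
theorem tendsto_cutMeasure_cutEventQ (hconn : G.Connected) (hqt : IsQuasiTransitive G) (o : V)
    (p : unitInterval) (x t : V) :
    Tendsto (fun i => cutMeasureQ G hqt o p {ζ : CutSpaceQ G hqt o | cutPQ G hqt o ζ x t ∧
      t ∉ cutClsQ G hconn hqt o i ζ x}) atTop (𝓝 0) := by
  have hN : cutMeasureQ G hqt o p {ζ : CutSpaceQ G hqt o | ¬ ζ.conf ⊆ G.edgeSet} = 0 := ae_iff.1 (ae_conf_subsetQ p)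
  refine tendsto_of_tendsto_of_tendsto_of_le_of_le tendsto_const_nhds
    (tendsto_cutMeasure_splitEventQ hconn hqt o p x t) (fun i => bot_le) fun i => ?_
  calc cutMeasureQ G hqt o p {ζ : CutSpaceQ G hqt o | cutPQ G hqt o ζ x t ∧ t ∉ cutClsQ G hconn hqt o i ζ x}
      ≤ cutMeasureQ G hqt o p ({ζ | ¬ ζ.conf ⊆ G.edgeSet} ∪ {ζ | (openGraph ζ.conf).Reachable x t ∧
          ∀ F : Finset V, x ∈ F → t ∈ openClusterIn (withinGraph ⊤ (↑F : Set V)) ζ.conf x →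
            ∃ v ∈ F, ¬ LevelExhaustionRelQ G hconn hqt o i ζ.seed x v}) :=
        measure_mono (cutEvent_subsetQ hconn hqt o i x t)
    _ ≤ cutMeasureQ G hqt o p {ζ | ¬ ζ.conf ⊆ G.edgeSet} + _ := measure_union_le _ _
    _ = _ := by rw [hN, zero_add]

end Exhaustion

/-! ### The conclusion -/

section Conclusion

variable {G : SimpleGraph V} [G.LocallyFinite] [Countable V]

/-- **The forest of the cut route is almost surely empty**: given Lemma 5.3 (ii) on `(ω, θ)`,
`μ̃(x ∈ D) = 0` for every vertex `x` (`measure_mem_eq_zero_of_cut_exhaustion` with the class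
package, the forest package and the exhaustion in probability).
[cite: Timar2006, Thm. 5.5 (proof) and Lemma 5.3] -/
theorem cutMeasure_mem_cutD_eq_zeroQ (hconn : G.Connected) (hqt : IsQuasiTransitive G)
    (hU : ¬ IsGraphUnimodular G) (o : V) (p : unitInterval)
    (h53 : ∀ᵐ q ∂((bondPercolation G p).prod (volume : Measure UnitAddCircle)),
      ∀ x ∈ cutPoints G o q.1, ∀ u ∈ openCluster q.1 x, IsHeavy G o (branchSet q.1 x u) →
        ∃ z ∈ branchSet q.1 x u, IsEncounter G o q.1 z ∧ OnePartitionRelQ G o q.2 x z) (x : V) :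
    cutMeasureQ G hqt o p {ζ | x ∈ cutDQ G hqt o ζ} = 0 := by
  have hΔ0 := minEdgeRatio_ne_zero hconn hqt
  refine measure_mem_eq_zero_of_cut_exhaustion_quasiTransitive hconn hqt (cutMeasureQ G hqt o p) (cutActQ G hconn hqt o)
    (measurable_cutActQ G hconn hqt o) (map_cutActQ G hconn hqt o p) (D := cutDQ G hqt o) (P := cutPQ G hqt o)
    (cls := cutClsQ G hconn hqt o) measurableSet_mem_cutDQ measurableSet_cutPQ
    (fun i x y => measurableSet_mem_cutClsQ i x y) (fun γ ζ x => mem_cutD_act_iffQ hconn hqt γ ζ x)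
    (fun γ ζ x t => cutP_act_iffQ hconn hqt γ ζ x t) (fun i γ ζ x y => mem_cutCls_act_iffQ hconn hqt i γ ζ x y)
    o (B := (minEdgeRatio G)⁻¹) (ENNReal.inv_ne_top.2 hΔ0) (qtSupDegree G hqt)
    (ae_of_all _ fun ζ i x hx => cutCls_packageQ hconn hqt hU o ζ i x hx) ?_
    (fun x t => tendsto_cutMeasure_cutEventQ hconn hqt o p x t) x
  filter_upwards [ae_labels_injectiveQ p, ae_conf_subsetQ p, ae_confPar_of_aeQ (o := o) p h53]
    with ζ hlab hE h53ζ
  exact cutP_packageQ hqt o ζ hlab hE h53ζ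

/-- **Hence almost surely no vertex is an encounter point of a bad heavy cluster** (given
Lemma 5.3 (ii)). [cite: Timar2006, Thm. 5.5 (proof) and Lemma 5.3] -/
theorem ae_not_mem_cutPointsQ (hconn : G.Connected) (hqt : IsQuasiTransitive G)
    (hU : ¬ IsGraphUnimodular G) (o : V) (p : unitInterval)
    (h53 : ∀ᵐ q ∂((bondPercolation G p).prod (volume : Measure UnitAddCircle)),
      ∀ x ∈ cutPoints G o q.1, ∀ u ∈ openCluster q.1 x, IsHeavy G o (branchSet q.1 x u) →
        ∃ z ∈ branchSet q.1 x u, IsEncounter G o q.1 z ∧ OnePartitionRelQ G o q.2 x z) :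
    ∀ᵐ ω ∂(bondPercolation G p), ∀ x, x ∉ cutPoints G o ω := by
  rw [ae_all_iff]
  intro x
  rw [ae_iff]
  have h := cutMeasure_setOf_conf_memQ (G := G) (hqt := hqt) (o := o) p {ω | x ∈ cutPoints G o ω}
  simp only [not_not]
  simp only [Set.mem_setOf_eq] at h
  rw [← h]
  exact cutMeasure_mem_cutD_eq_zeroQ hconn hqt hU o p h53 x

/-- **Thm. 5.5 modulo Lemma 5.3, core**: on an infinite countable, connected, locally finite,
quasi-transitive, nonunimodular graph and for any `p`, "almost surely infinitely many bad heavy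
clusters" contradicts Lemma 5.3 (i) + (ii). [cite: Timar2006, Thm. 5.5 (proof) and Lemma 5.3] -/
theorem false_of_ae_infinite_bad_of_lemma53Q (hconn : G.Connected) (hqt : IsQuasiTransitive G)
    (hU : ¬ IsGraphUnimodular G) (o : V) (p : unitInterval)
    (hbad : ∀ᵐ ω ∂(bondPercolation G p), (badHeavyClusters G o ω).Infinite)
    (h53i : (∀ᵐ ω ∂(bondPercolation G p), (badHeavyClusters G o ω).Infinite) →
      ¬ ∀ᵐ ω ∂(bondPercolation G p), ∀ x, x ∉ cutPoints G o ω)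
    (h53ii : ∀ᵐ q ∂((bondPercolation G p).prod (volume : Measure UnitAddCircle)),
      ∀ x ∈ cutPoints G o q.1, ∀ u ∈ openCluster q.1 x, IsHeavy G o (branchSet q.1 x u) →
        ∃ z ∈ branchSet q.1 x u, IsEncounter G o q.1 z ∧ OnePartitionRelQ G o q.2 x z) : False :=
  h53i hbad (ae_not_mem_cutPointsQ hconn hqt hU o p h53ii)

end Conclusion


/-! ### Thm. 5.5 on quasi-transitive graphs -/

/-- **Reduction of Thm. 5.5 (quasi-transitive) to the refutation of "almost surely infinitely many
bad heavy clusters"** — the quasi-transitive twin of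
`Timar2006_finiteLevelUnion_of_not_ae_infinite_bad` (whose zero–one ingredient
`ae_infinite_badHeavyClusters_of_not_ae_empty` is already quasi-transitive).
[cite: Timar2006, Thm. 5.5 (proof, first paragraph)] -/
theorem finiteLevelUnion_quasiTransitive_of_not_ae_infinite_bad
    (h : ∀ {V : Type} [Infinite V] [Countable V] (G : SimpleGraph V) [G.LocallyFinite],
      G.Connected → IsQuasiTransitive G → ¬ IsGraphUnimodular G → ∀ (o : V) (p : unitInterval),
        0 < (p : ℝ) → (p : ℝ) < 1 →
        (∀ᵐ ω ∂(bondPercolation G p), (heavyClusters G o ω).Infinite) →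
          (∀ᵐ ω ∂(bondPercolation G p), (badHeavyClusters G o ω).Infinite) → False)
    {V : Type} (G : SimpleGraph V) [G.LocallyFinite] (hconn : G.Connected) (hqt : IsQuasiTransitive G)
    (hU : ¬ IsGraphUnimodular G) (o : V) (p : unitInterval)
    (hheavy : ∀ᵐ ω ∂(bondPercolation G p), (heavyClusters G o ω).Infinite) :
    ∀ᵐ ω ∂(bondPercolation G p), ∀ x : V, IsHeavy G o (openCluster ω x) →
      ∃ S : Finset V, ∃ y ∈ openCluster ω x,
        (openClusterIn (withinGraph G (levelUnion G S)) ω y).Infinite := by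
  rcases finite_or_infinite V with hfin | hinf
  · exfalso
    have hF : ∀ᵐ ω ∂(bondPercolation G p), False := by
      filter_upwards [hheavy] with ω hω
      apply hω
      have : heavyClusters G o ω = ∅ :=
        Set.eq_empty_of_forall_notMem fun C hC => (IsHeavy.infinite hconn hC) (Set.toFinite _)
      rw [this]
      exact Set.finite_empty
    rw [eventually_false_iff_eq_bot, ae_eq_bot] at hF
    exact IsProbabilityMeasure.ne_zero _ hF
  haveI : Nonempty V := ⟨o⟩
  haveI : Countable V := countable_of_connected_of_locallyFinite G hconn o
  have hp0 : 0 < (p : ℝ) := pos_of_ae_infinite_heavyClusters G hconn o p hheavy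
  have hp1 : (p : ℝ) < 1 := lt_one_of_ae_infinite_heavyClusters G hconn o p hheavy
  have hempty : ∀ᵐ ω ∂(bondPercolation G p), badHeavyClusters G o ω = ∅ := by
    by_contra hne
    exact h G hconn hqt hU o p hp0 hp1 hheavy
      (ae_infinite_badHeavyClusters_of_not_ae_empty G hconn hqt o p hheavy hne)
  filter_upwards [hempty] with ω hω
  exact (badHeavyClusters_eq_empty_iff G o ω).1 hω

/-- **Timár 2006, Thm. 5.5 on QUASI-TRANSITIVE graphs, PROVED.** "Consider Bernoulli percolation
on some nonunimodular [quasi-]transitive graph `G` and suppose that it has infinitely many heavy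
components. Then with probability 1, for any [heavy] component `C`, there is some finite union `L`
of levels such that `L ∩ C` has some infinite connected component": on a connected, locally finite,
quasi-transitive, nonunimodular graph, for every `p` with almost surely infinitely many heavy
clusters, almost surely every heavy cluster `C(x)` contains a vertex `y` whose open cluster
constrained to some finite union of levels is infinite. Proof: the cut route
(`cutMeasure_mem_cutD_eq_zeroQ`) with Lemma 5.3 (i) (`not_ae_forall_not_badEncounter`) and
Lemma 5.3 (ii) (`ae_exists_isEncounter_of_branch_quasiTransitive`), through
`finiteLevelUnion_quasiTransitive_of_not_ae_infinite_bad`.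
[cite: Timar2006, Thm. 5.5] [cite: Hutchcroft2016, §2 (proof of Thm. 1.1)] -/
theorem Timar2006_finiteLevelUnion_quasiTransitive {V : Type} (G : SimpleGraph V) [G.LocallyFinite]
    (hconn : G.Connected) (hqt : IsQuasiTransitive G) (hU : ¬ IsGraphUnimodular G) (o : V)
    (p : unitInterval) (hheavy : ∀ᵐ ω ∂(bondPercolation G p), (heavyClusters G o ω).Infinite) :
    ∀ᵐ ω ∂(bondPercolation G p), ∀ x : V, IsHeavy G o (openCluster ω x) →
      ∃ S : Finset V, ∃ y ∈ openCluster ω x,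
        (openClusterIn (withinGraph G (levelUnion G S)) ω y).Infinite := by
  refine finiteLevelUnion_quasiTransitive_of_not_ae_infinite_bad ?_ G hconn hqt hU o p hheavy
  intro V _ _ G _ hconn hqt hU o p hp0 hp1 _ hbad
  refine false_of_ae_infinite_bad_of_lemma53Q hconn hqt hU o p hbad
    (fun hbad' => not_ae_forall_not_badEncounter hconn o hp0 hp1 hbad') ?_
  filter_upwards [ae_exists_isEncounter_of_branch_quasiTransitive hconn hqt hU hp0 hp1 o] with q hq x hx u hu hH
  exact hq x hx.2.2 u hu hH

end Literature.Barriers.CriticalPhenomena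

end
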